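/-
Copyright: the b2b-balaban T⁴-continuum CRUX team, row NE7b, leaf lineage `t4-ne7b-formalise-leaf-02` (gen 131). Project licence.
-/
import Summits.QuantumFields.BalabanUV.T4Continuum.Spine.NE7b.BlockSurfaceMultiplicity
import Summits.QuantumFields.BalabanUV.T4Continuum.Spine.NE7b.CovariantStokesCounting
import Mathlib.Tactic.FieldSimp

/-!
# THE (5.2) COUNTING ON THE TWO-SCALE TORUS, BY VALUE: with `…CovariantStokesCounting`'s abstract letters DISCHARGED by
# `…BlockSurfaceMultiplicity`'s kernel counts (block weight `η^d = n^{−d}`, `u = η²`, `v = η`, `t = 4`, `m₁ = n²η^d`, `m₂ = 2(d−1)n·η^d`), the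
# Lemma-CS-shaped per-plaquette bound sums to `Σ_P X(P)² ≤ 2η^d·Σ_q F(q)² + 16(d−1)η^d·ε²·Σ_b A(b)²` — the memo's «`8‖D_UA‖² + 32(d−1)c_g²ε_F²‖A‖²`»
# with its two generous factors `4` and `2` removed (row NE7b, node U5c; the (h1) slot of print's `γ₀` assembly, `SectE-interface-proof.md` §5.2)

Cell `pub-balaban`, sub-cell `t4`, spine estimate NE7b (`T4WeightBudget.RelWeightBound`; the cell's OWN estimate — NOT PRINTED in
[Bałaban 1983–89], NOT PROVED).  Crux-route work under `Spine/NE7b/` by the row's E-side ∕ key-readings ∕ lattice-geometry leaf lineage; NOTHING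
of Bałaban's is named or asserted; no `T4Continuum/Support` leaf typed; no `def`, no notation; zero `sorry`.  Imports: this lineage's
`…BlockSurfaceMultiplicity` and leaf-05 g154's `…CovariantStokesCounting`.

WHAT IS PROVED ([folklore]): on the two-scale torus `(ℤ∕nM)^d` (`0 < n`; coarse plaquettes `P = (y, a)`, `y : Fin d → ZMod M`, block offsets
`r : Fin d → Fin n`, block point `x = n·y + r`; based squares `Sq x a` and boundaries `Bd x a` as characterised in `…BlockSurfaceMultiplicity`),
for every per-plaquette datum `X P`, `a P r ≥ 0` with the Lemma-CS-shaped letters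
`|X P| ≤ Σ_r n^{−d}·(a P r + ε·Σ_{b∈Bd} n^{−1}|A b|)`, `a P r ≤ Σ_{q∈Sq} n^{−2}|F q|` (DISPLAYED — Lemma CS itself),
**`sum_sq_le_twoScale`**: `Σ_P (X P)² ≤ 2·n^{−d}·Σ_q (F q)² + 16·(d−1)·n^{−d}·ε²·Σ_b (A b)²` — `…CovariantStokesCounting.sum_sq_le_of_blockAverage_bound`
BY NAME with `w := n^{−d}` (`Σ_r w = 1` since `#(Fin d → Fin n) = n^d`), `u := n^{−2}`, `v := n^{−1}`, `t := 4` (`hS`, `hT` =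
`…BlockSurfaceMultiplicity` §3), `m₁ := n²·n^{−d}`, `m₂ := 2(d−1)n·n^{−d}` (`hm₁`, `hm₂` = `…BlockSurfaceMultiplicity` §4: a constant weight times a
count).

NOT HERE (honest): Lemma CS (i)–(iii) themselves (`…LinearisedLatticeStokes(Rectangle)` + the readings (R-M), (R-V), `c_g ε_F`) — i.e. that
print's `(∂_V M_k A)(P)` obeys `hX` ∕ `ha` with these sets; which `M, n = L^k, d` are Bałaban's; the `L²` normalisations `‖·‖² = η^d Σ (·)²`
((A3) ∕ (A1c); NC-NE7b-α UNRULED); anything of Bałaban's.  BY-NAME EFFECT ON THE WALL: NONE.  NE7b NOT PRINTED ∕ NOT PROVED; spine PROVED 0∕9;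
rung (B)+1 on a FINITE torus — NOT infinite volume, NOT the mass gap, NOT Clay.
HONEST DEPENDENCY: continuum YM on T⁴ ⇐ BetaPertH ∧ nine spine estimates (0/9 proved); BetaPertH ⇐ (D1) ∧ (D4) ∧ CAP+tail.
-/

set_option autoImplicit false

namespace Summit.QuantumFields.BalabanUV.T4Continuum.NE7b.BlockSurfaceCounting

open Finset
open Summit.QuantumFields.BalabanUV.T4Continuum.NE7b.BlockSurfaceMultiplicity
open Summit.QuantumFields.BalabanUV.T4Continuum.NE7b.CovariantStokesCounting

variable {d M : ℕ} (n : ℕ)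

/-- A constant weight against a membership test sums to the weight times the count (the shape of `…CovariantStokesCounting`'s `hm₁` ∕ `hm₂`
for a uniform block weight). [folklore] -/
theorem sum_sum_ite_const_eq_mul_card {P X : Type*} [Fintype P] [Fintype X] (c : ℝ) (mem : P → X → Prop)
    [∀ p x, Decidable (mem p x)] :
    ∑ p, ∑ x, (if mem p x then c else 0) = c * ((univ.filter fun px : P × X => mem px.1 px.2).card : ℝ) := by
  classical
  rw [← Fintype.sum_prod_type' (fun p x => if mem p x then c else 0)]
  rw [← Finset.sum_filter, Finset.sum_const, nsmul_eq_mul, mul_comm]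

/-- **THE (5.2) COUNTING ON THE TWO-SCALE TORUS, BY VALUE** — `Σ_P (X P)² ≤ 2·n^{−d}·Σ_q (F q)² + 16·(d−1)·n^{−d}·ε²·Σ_b (A b)²` from the
Lemma-CS-shaped per-plaquette letters, every counting letter of `…CovariantStokesCounting.sum_sq_le_of_blockAverage_bound` discharged by
`…BlockSurfaceMultiplicity` (`w = n^{−d}`, `u = n^{−2}`, `v = n^{−1}`, `t = 4`, `m₁ = n²n^{−d}`, `m₂ = 2(d−1)n·n^{−d}`). [folklore] -/
theorem sum_sq_le_twoScale [NeZero M] [NeZero (n * M)] (hn : 0 < n)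
    (Sq : (Fin d → ZMod (n * M)) → {a : Fin d × Fin d // a.1 < a.2} →
      Finset ((Fin d → ZMod (n * M)) × {a : Fin d × Fin d // a.1 < a.2}))
    (hSq : ∀ x a, Sq x a = univ.image (fun ij : Fin n × Fin n =>
      (x + Pi.single a.1.1 ((ij.1 : ℕ) : ZMod (n * M)) + Pi.single a.1.2 ((ij.2 : ℕ) : ZMod (n * M)), a)))
    (Bd : (Fin d → ZMod (n * M)) → {a : Fin d × Fin d // a.1 < a.2} → Finset ((Fin d → ZMod (n * M)) × Fin d))
    (hBd : ∀ x a, Bd x a = univ.image (fun csi : Bool × Bool × Fin n =>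
        if csi.1 then
          (if csi.2.1 then x + Pi.single a.1.1 ((csi.2.2 : ℕ) : ZMod (n * M))
            else x + Pi.single a.1.2 (n : ZMod (n * M)) + Pi.single a.1.1 ((csi.2.2 : ℕ) : ZMod (n * M)), a.1.1)
        else
          (if csi.2.1 then x + Pi.single a.1.2 ((csi.2.2 : ℕ) : ZMod (n * M))
            else x + Pi.single a.1.1 (n : ZMod (n * M)) + Pi.single a.1.2 ((csi.2.2 : ℕ) : ZMod (n * M)), a.1.2)))
    (Xv : (Fin d → ZMod M) × {a : Fin d × Fin d // a.1 < a.2} → ℝ)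
    (av : (Fin d → ZMod M) × {a : Fin d × Fin d // a.1 < a.2} → (Fin d → Fin n) → ℝ)
    (F : (Fin d → ZMod (n * M)) × {a : Fin d × Fin d // a.1 < a.2} → ℝ) (A : (Fin d → ZMod (n * M)) × Fin d → ℝ) {ε : ℝ} (hε : 0 ≤ ε)
    (ha0 : ∀ p r, 0 ≤ av p r)
    (ha : ∀ p r, av p r ≤ ∑ q ∈ Sq (fun i => (((p.1 i).val * n + (r i : ℕ) : ℕ) : ZMod (n * M))) p.2, (1 / (n : ℝ) ^ 2) * |F q|)
    (hX : ∀ p, |Xv p| ≤ ∑ r : Fin d → Fin n, (1 / (n : ℝ) ^ d) *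
      (av p r + ε * ∑ b ∈ Bd (fun i => (((p.1 i).val * n + (r i : ℕ) : ℕ) : ZMod (n * M))) p.2, (1 / (n : ℝ)) * |A b|)) :
    ∑ p, Xv p ^ 2 ≤ 2 * (1 / (n : ℝ) ^ d) * ∑ q, F q ^ 2 + 16 * ((d - 1 : ℕ) : ℝ) * (1 / (n : ℝ) ^ d) * ε ^ 2 * ∑ b, A b ^ 2 := by
  classical
  have hn0 : (0 : ℝ) < (n : ℝ) := by exact_mod_cast hn
  have hnd : (0 : ℝ) < (n : ℝ) ^ d := pow_pos hn0 d
  -- the abstract counting with every letter supplied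
  have h := sum_sq_le_of_blockAverage_bound
    (P := (Fin d → ZMod M) × {a : Fin d × Fin d // a.1 < a.2}) (X := Fin d → Fin n)
    (fun _ _ => 1 / (n : ℝ) ^ d)
    (fun p r => Sq (fun i => (((p.1 i).val * n + (r i : ℕ) : ℕ) : ZMod (n * M))) p.2)
    (fun p r => Bd (fun i => (((p.1 i).val * n + (r i : ℕ) : ℕ) : ZMod (n * M))) p.2)
    Xv av F A (u := 1 / (n : ℝ) ^ 2) (v := 1 / (n : ℝ)) (t := 4) (ε := ε)
    (m₁ := 1 / (n : ℝ) ^ d * (n : ℝ) ^ 2) (m₂ := 1 / (n : ℝ) ^ d * (2 * ((d - 1 : ℕ) : ℝ) * n))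
    (fun _ _ => by positivity)
    (fun _ => by
      rw [Finset.sum_const, Finset.card_univ, Fintype.card_fun, Fintype.card_fin, Fintype.card_fin, nsmul_eq_mul, Nat.cast_pow,
        mul_one_div, div_self hnd.ne'])
    (by positivity) (by positivity) (by norm_num) hε
    (fun p r => card_square_mul_inv_sq_le_one n Sq hn hSq _ _)
    (fun p r => card_boundary_mul_inv_le_four n Bd hn hBd _ _)
    (fun q => by
      rw [sum_sum_ite_const_eq_mul_card]
      exact mul_le_mul_of_nonneg_left (by exact_mod_cast block_square_multiplicity_le n hn Sq hSq q) (by positivity))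
    (fun b => by
      rw [sum_sum_ite_const_eq_mul_card]
      exact mul_le_mul_of_nonneg_left (by exact_mod_cast block_boundary_multiplicity_le n hn Bd hBd b) (by positivity))
    ha0 ha hX
  -- the constants: `2·m₁·u = 2n^{−d}`, `2·t·m₂·v = 16(d−1)n^{−d}`
  have h1 : 2 * (1 / (n : ℝ) ^ d * (n : ℝ) ^ 2) * (1 / (n : ℝ) ^ 2) = 2 * (1 / (n : ℝ) ^ d) := by
    field_simp
  have h2 : 2 * 4 * (1 / (n : ℝ) ^ d * (2 * ((d - 1 : ℕ) : ℝ) * n)) * ε ^ 2 * (1 / (n : ℝ)) =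
      16 * ((d - 1 : ℕ) : ℝ) * (1 / (n : ℝ) ^ d) * ε ^ 2 := by
    field_simp
    ring
  rw [h1, h2] at h
  exact h

end Summit.QuantumFields.BalabanUV.T4Continuum.NE7b.BlockSurfaceCounting
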